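import Literature.NumberTheory.Sieve.ChenTheoremISwitchedSieve
import Literature.NumberTheory.Sieve.ChenShifted
import Literature.NumberTheory.Sieve.ChenSieveProductFixed
import HarnessLib

/-!
# Chen's Theorem II: the sieve step of the switching bound (C) for a fixed even shift `h`

Companion of `ChenShiftedAssembly.lean` (the assembly of Chen's Theorem II, Chen Jing-run, Sci. Sinica
16 (1973), Thm II, from three sieve estimates for `𝒜_h(x) = {p + h : p ≤ x}` at the sieving level
`x^{1/10}`). Its hypothesis (C) is Chen's Lemma 8 for the switched set
`B_h(x) = {p₁p₂p₃ − h : x^{1/10} ≤ p₁ < y ≤ p₂ ≤ p₃, p₁p₂p₃ ≤ x + h}` (`chenSetBShift`). Exactly as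
`ChenTheoremISwitchedSieve` does for the Goldbach set `{x − p₁p₂p₃}` (which is `ChenSwitchedSieve` with
the grid of `p₁` started at `x^{1/10}`), this file sets up the enlarged set of triples and PROVES the
SIEVE STEP; the only change of substance is that the rôle of the even number is split: `x` is the size
(ranges, grid `ℓ(p) = x^{1/10}(1+ε)^k`, `y = x^{1/3}`), the fixed shift `h` is the modulus (weights
`|h − p₁p₂p₃| = p₁p₂p₃ − h`, density `shiftedPrimesDensity h`, coprimality conditions):

* `switchedTriplesS h x ε` (`T̃`: `x^{1/10} ≤ p₁ < y ≤ p₂ ≤ p₃ < x`, `p₁ ∤ h`, `(p₂p₃, h) = 1`,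
  `ℓ(p₁)p₂p₃ < x`), the sifted sequence `switchedSeqS` (weights `#{t : |h − p₁p₂p₃| = n}`, density
  `shiftedPrimesDensity h`, size `#T̃`) and its remainder `switchedRemainderS h x ε D`;
* `roughCount_chenSetBShift_le_cardS` — `S(B_h(x), chenY) ≤ #{t ∈ T̃ : (p₁p₂p₃ − h, P(y)) = 1} + h` once
  `2h < x^{1/10}` (the `≤ h` elements with `p₁p₂p₃ ∈ (x, x + h]` are set aside);
* the sieve step `switchedCountS_le`: for `0 < ε ≤ 1`, `0 < δ ≤ 1/8`, `θ > 0` and all large `x`,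
  `#{t ∈ T̃ : (p₁p₂p₃ − h, P(y)) = 1} ≤ (2e^γ/(5(1 − 2δ)) + θ) · #T̃ · V_h(x^{1/10}) + R(h, x, ε, x^{1/2−δ})`
  (uniform linear-sieve upper bound `LinearSieve.upper_explicit` at level `x^{1/2−δ}`, `s = 3(1/2 − δ)`,
  and `V_h(y)/V_h(x^{1/10}) ≤ (3/10)(1 + o(1))` from the fixed-shift Mertens estimate
  `abs_sieveProduct_sub_le_of_lt` of `ChenSieveProductFixed` at `y` and at `x^{1/10}`).

The remainder bound and the count of `T̃` (ports of `ChenTheoremISwitchedRemainder` / `…Count`) are the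
next files. No named facts.

## References

* Chen Jing-run, Sci. Sinica 16 (1973) 157–176, Lemma 8 and §III (reprint: Wang Yuan (ed.),
  *Goldbach Conjecture*, 1984, PDF pp. 166–168). [ChenSciSinica1973]
* M. B. Nathanson, *Additive Number Theory: The Classical Bases*, GTM 164 (1996), Thm 10.6 and its
  proof, (10.12)–(10.15). [Nathanson1996]
-/

open Finset Filter Topology

noncomputable section

namespace Literature.NumberTheory.Sieve.Chen

open SieveSequence ChenSieve

/-! ### The enlarged set of triples `T̃(h, x, ε)` -/

/-- The enlarged index set `T̃(h, x, ε)` of the switched set `B_h(x)`: triples of primes `(p₁, p₂, p₃)`,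
all `< x`, with `x^{1/10} ≤ p₁ < x^{1/3} ≤ p₂ ≤ p₃`, `p₁ ∤ h`, `(p₂p₃, h) = 1` and `ℓ(p₁) p₂ p₃ < x`
(`ℓ = chenGridPointT x ε`; Nathanson (10.13)–(10.14) with the shift `h` in place of `N` in the
coprimality conditions). [cite: Nathanson1996, Thm 10.6 (proof, (10.13)–(10.14))] -/
def switchedTriplesS (h x : ℕ) (ε : ℝ) : Finset (ℕ × ℕ × ℕ) :=
  (Finset.range x ×ˢ Finset.range x ×ˢ Finset.range x).filter fun t : ℕ × ℕ × ℕ =>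
    t.1.Prime ∧ t.2.1.Prime ∧ t.2.2.Prime ∧ (x : ℝ) ^ (1 / 10 : ℝ) ≤ (t.1 : ℝ) ∧ (t.1 : ℝ) < y x ∧
      y x ≤ (t.2.1 : ℝ) ∧ t.2.1 ≤ t.2.2 ∧ ¬t.1 ∣ h ∧ (t.2.1 * t.2.2).Coprime h ∧
        chenGridPointT x ε t.1 * t.2.1 * t.2.2 < (x : ℝ)

/-- Membership in `T̃(h, x, ε)`. [folklore] -/
theorem mem_switchedTriplesS {h x : ℕ} {ε : ℝ} {t : ℕ × ℕ × ℕ} :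
    t ∈ switchedTriplesS h x ε ↔ (t.1 < x ∧ t.2.1 < x ∧ t.2.2 < x) ∧
      t.1.Prime ∧ t.2.1.Prime ∧ t.2.2.Prime ∧ (x : ℝ) ^ (1 / 10 : ℝ) ≤ (t.1 : ℝ) ∧ (t.1 : ℝ) < y x ∧
      y x ≤ (t.2.1 : ℝ) ∧ t.2.1 ≤ t.2.2 ∧ ¬t.1 ∣ h ∧ (t.2.1 * t.2.2).Coprime h ∧
        chenGridPointT x ε t.1 * t.2.1 * t.2.2 < (x : ℝ) := by
  simp only [switchedTriplesS, Finset.mem_filter, Finset.mem_product, Finset.mem_range]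

/-- For `t = (p₁, p₂, p₃) ∈ T̃(h, x, ε)` (`0 < ε ≤ 1`): `p₁p₂p₃ < 2x` and `p₁p₂p₃ ≠ h`, hence
`1 ≤ |h − p₁p₂p₃| ≤ 2x` (`p₁ < (1+ε)ℓ(p₁) ≤ 2ℓ(p₁)`, `ℓ(p₁)p₂p₃ < x`, `(p₂p₃, h) = 1`, `h < x`).
[folklore] -/
theorem tripleDist_pos_and_leS {h x : ℕ} {ε : ℝ} (hε : 0 < ε) (hε1 : ε ≤ 1) (hhx : h ≤ x)
    {t : ℕ × ℕ × ℕ} (ht : t ∈ switchedTriplesS h x ε) :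
    1 ≤ tripleDist h t ∧ tripleDist h t ≤ 2 * x := by
  obtain ⟨⟨hx1, -, -⟩, h₁, h₂, h₃, hz, -, -, -, -, hcop, hlt⟩ := mem_switchedTriplesS.mp ht
  have hxpos : 0 < x := by omega
  -- `p₁p₂p₃ < 2x`
  have hp : (x : ℝ) ^ (1 / 10 : ℝ) ≤ t.1 := hz
  have hltg := lt_mul_chenGridPointT hxpos hε hp
  have hℓ := chenGridPointT_pos hxpos hε t.1
  have h23 : (0 : ℝ) < (t.2.1 : ℝ) * t.2.2 := by
    have := h₂.pos; have := h₃.pos; positivity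
  have h2N : t.1 * t.2.1 * t.2.2 < 2 * x := by
    have hreal : ((t.1 * t.2.1 * t.2.2 : ℕ) : ℝ) < 2 * x := by
      push_cast
      calc (t.1 : ℝ) * t.2.1 * t.2.2 = (t.1 : ℝ) * ((t.2.1 : ℝ) * t.2.2) := by ring
        _ < (1 + ε) * chenGridPointT x ε t.1 * ((t.2.1 : ℝ) * t.2.2) := by gcongr
        _ ≤ 2 * chenGridPointT x ε t.1 * ((t.2.1 : ℝ) * t.2.2) := by gcongr; linarith
        _ = 2 * (chenGridPointT x ε t.1 * t.2.1 * t.2.2) := by ring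
        _ ≤ 2 * x := by linarith
    exact_mod_cast hreal
  -- `p₁p₂p₃ ≠ h`
  have hne : t.1 * t.2.1 * t.2.2 ≠ h := by
    intro heq
    have hdvd : t.2.1 * t.2.2 ∣ h := ⟨t.1, by rw [← heq]; ring⟩
    have h1 : t.2.1 * t.2.2 = 1 := Nat.Coprime.eq_one_of_dvd hcop hdvd
    have := h₂.two_le
    have := h₃.two_le
    nlinarith
  unfold tripleDist
  constructor
  · rw [Nat.one_le_iff_ne_zero, Ne, Int.natAbs_eq_zero, sub_eq_zero]
    intro heq
    exact hne (by exact_mod_cast heq.symm)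
  · have key : ((((h : ℤ) - t.1 * t.2.1 * t.2.2).natAbs : ℕ) : ℤ) ≤ 2 * x := by
      rw [Int.natCast_natAbs, abs_le]
      have h2N' : ((t.1 * t.2.1 * t.2.2 : ℕ) : ℤ) < 2 * x := by exact_mod_cast h2N
      have hhx' : (h : ℤ) ≤ x := by exact_mod_cast hhx
      push_cast at h2N'
      constructor
      · linarith
      · have : (0 : ℤ) ≤ (t.1 : ℤ) * t.2.1 * t.2.2 := by positivity
        linarith
    exact_mod_cast key

/-! ### The sifted sequence carried by `T̃(h, x, ε)` -/

/-- The weights of the enlarged switched sequence: `a(n) = #{t ∈ T̃(h, x, ε) : |h − p₁p₂p₃| = n}`.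
[cite: Nathanson1996, Thm 10.6 (proof)] -/
def switchedWeightS (h x : ℕ) (ε : ℝ) (n : ℕ) : ℝ :=
  #((switchedTriplesS h x ε).filter fun t : ℕ × ℕ × ℕ => tripleDist h t = n)

/-- **The enlarged switched sequence** for the shift `h`: weights `switchedWeightS`, density
`shiftedPrimesDensity h`, size `#T̃(h, x, ε)`. [cite: Nathanson1996, Thm 10.6 (proof)] -/
def switchedSeqS (h x : ℕ) (ε : ℝ) : SieveSequence where
  a := switchedWeightS h x ε
  a_nonneg := fun _ => Nat.cast_nonneg _
  size := fun _ => #(switchedTriplesS h x ε)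
  density := shiftedPrimesDensity h
  density_mult := isMultiplicative_shiftedPrimesDensity h

/-- The remainder of the enlarged switched sequence up to level `D`, sifting primes `< y = x^{1/3}`:
`R(h, x, ε, D) = ∑_{d < D, d ∣ P(y)} |#{t ∈ T̃ : d ∣ |h − p₁p₂p₃|} − g(d) · #T̃|`.
[cite: Nathanson1996, Thm 10.6 (proof, (10.15))] -/
def switchedRemainderS (h x : ℕ) (ε D : ℝ) : ℝ :=
  ∑ d ∈ (Finset.range ⌈D⌉₊).filter (· ∣ primesProdBelow (y x)),
    |(#((switchedTriplesS h x ε).filter fun t : ℕ × ℕ × ℕ => d ∣ tripleDist h t) : ℝ) -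
      shiftedPrimesDensity h d * #(switchedTriplesS h x ε)|

/-- `R(h, x, ε, D) ≥ 0`. [folklore] -/
theorem switchedRemainderS_nonneg (h x : ℕ) (ε D : ℝ) : 0 ≤ switchedRemainderS h x ε D :=
  Finset.sum_nonneg fun _ _ => abs_nonneg _

/-- `∑_{n ∈ S} a(n) = #{t ∈ T̃ : |h − p₁p₂p₃| ∈ S}`. [folklore] -/
theorem sum_switchedWeightS_eq (h x : ℕ) (ε : ℝ) (S : Finset ℕ) :
    ∑ n ∈ S, switchedWeightS h x ε n =
      #((switchedTriplesS h x ε).filter fun t : ℕ × ℕ × ℕ => tripleDist h t ∈ S) := by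
  unfold switchedWeightS
  exact sum_card_filter_eq_card_filter_mem _ _ _

/-- `S(𝒜̃, P; 2x) = #{t ∈ T̃ : (|h − p₁p₂p₃|, P) = 1}` (every `|h − p₁p₂p₃|` lies in `(0, 2x]`,
`h ≤ x`). [folklore] -/
theorem sifted_switchedSeqS_eq {h x : ℕ} {ε : ℝ} (hε : 0 < ε) (hε1 : ε ≤ 1) (hhx : h ≤ x) (P : ℕ) :
    (switchedSeqS h x ε).sifted ((2 * x : ℕ) : ℝ) P =
      #((switchedTriplesS h x ε).filter fun t : ℕ × ℕ × ℕ => (tripleDist h t).Coprime P) := by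
  change ∑ n ∈ (Finset.Ioc 0 ⌊((2 * x : ℕ) : ℝ)⌋₊).filter (fun n : ℕ => n.Coprime P),
    switchedWeightS h x ε n = _
  rw [Nat.floor_natCast, sum_switchedWeightS_eq]
  congr 2
  refine Finset.filter_congr fun t ht => ?_
  have hb := tripleDist_pos_and_leS hε hε1 hhx ht
  simp only [Finset.mem_filter, Finset.mem_Ioc]
  constructor
  · exact fun hh => hh.2
  · exact fun hh => ⟨⟨by omega, hb.2⟩, hh⟩

/-- `|𝒜̃_d|(2x) = #{t ∈ T̃ : d ∣ |h − p₁p₂p₃|}`. [folklore] -/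
theorem congrSum_switchedSeqS_eq {h x : ℕ} {ε : ℝ} (hε : 0 < ε) (hε1 : ε ≤ 1) (hhx : h ≤ x) (d : ℕ) :
    (switchedSeqS h x ε).congrSum d ((2 * x : ℕ) : ℝ) =
      #((switchedTriplesS h x ε).filter fun t : ℕ × ℕ × ℕ => d ∣ tripleDist h t) := by
  change ∑ n ∈ (Finset.Ioc 0 ⌊((2 * x : ℕ) : ℝ)⌋₊).filter (d ∣ ·), switchedWeightS h x ε n = _
  rw [Nat.floor_natCast, sum_switchedWeightS_eq]
  congr 2
  refine Finset.filter_congr fun t ht => ?_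
  have hb := tripleDist_pos_and_leS hε hε1 hhx ht
  simp only [Finset.mem_filter, Finset.mem_Ioc]
  constructor
  · exact fun hh => hh.2
  · exact fun hh => ⟨⟨by omega, hb.2⟩, hh⟩

/-- The remainder sum of the sieve theorem for `𝒜̃` at height `2x` is `R(h, x, ε, D)`. [folklore] -/
theorem sum_abs_remainder_switchedSeqS_eq {h x : ℕ} {ε : ℝ} (hε : 0 < ε) (hε1 : ε ≤ 1) (hhx : h ≤ x)
    (D : ℝ) :
    ∑ d ∈ (Finset.range ⌈D⌉₊).filter (· ∣ primesProdBelow (y x)),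
        |(switchedSeqS h x ε).remainder d ((2 * x : ℕ) : ℝ)| = switchedRemainderS h x ε D := by
  unfold switchedRemainderS
  refine Finset.sum_congr rfl fun d _ => ?_
  rw [SieveSequence.remainder, congrSum_switchedSeqS_eq hε hε1 hhx]
  rfl

/-- `V(P(w))` for the density `shiftedPrimesDensity h` is `V_h(w) = sieveProduct h w`.
[cite: Nathanson1996, (10.8)] -/
theorem densityProduct_switchedSeqS_eq (h x : ℕ) (ε : ℝ) (w : ℝ) :
    (switchedSeqS h x ε).densityProduct (primesProdBelow w) = sieveProduct h w :=
  densityProduct_chenGoldbachSeq h w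

/-! ### From `B_h(x)` to `T̃(h, x, ε)` -/

/-- **`S(B_h(x), chenY) ≤ #{t ∈ T̃(h, x, ε) : (p₁p₂p₃ − h, P(x^{1/3})) = 1} + (h + 1)`** when
`2h < x^{1/10}` and `h ≠ 0`: an element `b = p₁p₂p₃ − h` of `B_h(x)` (`⌈x^{1/10}⌉ ≤ p₁ < chenY ≤ p₂ ≤ p₃`,
`p₁p₂p₃ ≤ x + h`) without prime factors `< chenY ≥ x^{1/3}` either has `p₁p₂p₃ < x` — then `p₁ < x^{1/3}`
(as `p₂, p₃ ≥ (x + h + 1)^{1/3} ≥ x^{1/3}`), all `pᵢ > 2h` give the coprimality conditions, `ℓ(p₁) ≤ p₁`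
gives `(p₁, p₂, p₃) ∈ T̃`, and `|h − p₁p₂p₃| = b` is coprime to `P(x^{1/3})` — or `p₁p₂p₃ ∈ [x, x + h]`,
i.e. `b ∈ [x − h, x]`, at most `h + 1` values. [cite: Nathanson1996, Thm 10.6 (proof, (10.14))] -/
theorem roughCount_chenSetBShift_le_cardS {h x : ℕ} {ε : ℝ} (hε : 0 < ε) (hh0 : h ≠ 0)
    (hhz : (2 * h : ℝ) < (x : ℝ) ^ (1 / 10 : ℝ)) (hx : 1 ≤ x) :
    roughCount (chenSetBShift h x) (chenY h x) ≤
      #((switchedTriplesS h x ε).filter fun t : ℕ × ℕ × ℕ =>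
        (tripleDist h t).Coprime (primesProdBelow (y x))) + (h + 1) := by
  classical
  have hxpos : 0 < x := by omega
  have hx0 : (0 : ℝ) < x := by exact_mod_cast hxpos
  have hzc : (x : ℝ) ^ (1 / 10 : ℝ) ≤ chenZ x := rpow_le_chenZ x
  set w : ℝ := ((x : ℝ) + h + 1) ^ (1 / 3 : ℝ) with hw
  have hw0 : 0 ≤ w := Real.rpow_nonneg (by positivity) _
  have hYw : w ≤ chenY h x := Nat.le_ceil _
  have hxw : (x : ℝ) ^ (1 / 3 : ℝ) ≤ w := Real.rpow_le_rpow hx0.le (by linarith) (by norm_num)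
  have hy : y x = (x : ℝ) ^ (1 / 3 : ℝ) := rfl
  have hcube : (x : ℝ) ^ (1 / 3 : ℝ) * (x : ℝ) ^ (1 / 3 : ℝ) * (x : ℝ) ^ (1 / 3 : ℝ) = x := by
    rw [← Real.rpow_add hx0, ← Real.rpow_add hx0]; norm_num
  set T := (switchedTriplesS h x ε).filter fun t : ℕ × ℕ × ℕ =>
    (tripleDist h t).Coprime (primesProdBelow (y x)) with hT
  set R := (chenSetBShift h x).filter fun n => IsRough (chenY h x) n with hR
  have hsplit : roughCount (chenSetBShift h x) (chenY h x) =
      #(R.filter fun b => b + h < x) + #(R.filter fun b => ¬ b + h < x) := by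
    rw [roughCount, ← hR, Finset.card_filter_add_card_filter_not]
  rw [hsplit]
  refine add_le_add ?_ ?_
  · -- the main part injects into `T` through `t ↦ |h − p₁p₂p₃|`
    calc #(R.filter fun b => b + h < x) ≤ #(T.image fun t : ℕ × ℕ × ℕ => tripleDist h t) :=
          Finset.card_le_card ?_
      _ ≤ #T := Finset.card_image_le
    intro b hb
    rw [Finset.mem_filter, hR, Finset.mem_filter] at hb
    obtain ⟨⟨hbB, hrough⟩, hbx⟩ := hb
    obtain ⟨p₁, p₂, p₃, hp₁, hp₂, hp₃, hz, hy1, hy2, h23, hprod, rfl⟩ := mem_chenSetBShift.mp hbB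
    -- sizes
    have hp₁z : (x : ℝ) ^ (1 / 10 : ℝ) ≤ p₁ := chenZ_le_iff.mp hz
    have hp₁h : 2 * h < p₁ := by
      have : (2 * h : ℝ) < (p₁ : ℝ) := hhz.trans_le hp₁z
      exact_mod_cast this
    have hp₂h : 2 * h < p₂ := by omega
    have hp₃h : 2 * h < p₃ := by omega
    have hp₁1 := hp₁.two_le
    have hp₂1 := hp₂.two_le
    have hp₃1 := hp₃.two_le
    have hP₁ : p₁ ≤ p₁ * p₂ * p₃ := by
      calc p₁ = p₁ * 1 * 1 := by ring
        _ ≤ p₁ * p₂ * p₃ := by gcongr <;> omega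
    have hP₂ : p₂ ≤ p₁ * p₂ * p₃ := by
      calc p₂ = 1 * p₂ * 1 := by ring
        _ ≤ p₁ * p₂ * p₃ := by gcongr <;> omega
    have hP₃ : p₃ ≤ p₁ * p₂ * p₃ := by
      calc p₃ = 1 * 1 * p₃ := by ring
        _ ≤ p₁ * p₂ * p₃ := by gcongr <;> omega
    have hPh : h ≤ p₁ * p₂ * p₃ := by omega
    have hPx : p₁ * p₂ * p₃ < x := by omega
    have hPx' : ((p₁ : ℝ) * p₂ * p₃) < x := by exact_mod_cast hPx
    have hp₂w : w ≤ p₂ := hYw.trans (by exact_mod_cast hy2)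
    have hp₃w : w ≤ p₃ := hp₂w.trans (by exact_mod_cast h23)
    have hp₂y : (x : ℝ) ^ (1 / 3 : ℝ) ≤ p₂ := hxw.trans hp₂w
    have hp₃y : (x : ℝ) ^ (1 / 3 : ℝ) ≤ p₃ := hxw.trans hp₃w
    have hp₁y : (p₁ : ℝ) < (x : ℝ) ^ (1 / 3 : ℝ) := by
      by_contra hcon
      have hcon' : (x : ℝ) ^ (1 / 3 : ℝ) ≤ p₁ := not_lt.mp hcon
      have h0 : (0 : ℝ) ≤ (x : ℝ) ^ (1 / 3 : ℝ) := Real.rpow_nonneg hx0.le _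
      have : (x : ℝ) ≤ (p₁ : ℝ) * p₂ * p₃ := by
        rw [← hcube]
        exact mul_le_mul (mul_le_mul hcon' hp₂y h0 (by positivity)) hp₃y h0 (by positivity)
      linarith
    rw [Finset.mem_image]
    refine ⟨(p₁, p₂, p₃), ?_, ?_⟩
    · rw [hT, Finset.mem_filter, mem_switchedTriplesS]
      refine ⟨⟨⟨(show p₁ < x by omega), (show p₂ < x by omega), (show p₃ < x by omega)⟩,
        hp₁, hp₂, hp₃, hp₁z, hp₁y, hp₂y, h23, ?_, ?_, ?_⟩, ?_⟩
      · exact fun hd => absurd (Nat.le_of_dvd (Nat.pos_of_ne_zero hh0) hd) (by omega)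
      · refine Nat.Coprime.mul_left ((Nat.Prime.coprime_iff_not_dvd hp₂).mpr fun hd => ?_)
          ((Nat.Prime.coprime_iff_not_dvd hp₃).mpr fun hd => ?_)
        · exact absurd (Nat.le_of_dvd (Nat.pos_of_ne_zero hh0) hd) (by omega)
        · exact absurd (Nat.le_of_dvd (Nat.pos_of_ne_zero hh0) hd) (by omega)
      · have hℓ := chenGridPointT_le hxpos hε hp₁z
        have hℓ0 := (chenGridPointT_pos hxpos hε p₁).le
        calc chenGridPointT x ε p₁ * p₂ * p₃ ≤ (p₁ : ℝ) * p₂ * p₃ := by gcongr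
          _ < x := hPx'
      · -- coprimality of `b = p₁p₂p₃ − h` with `P(x^{1/3})`
        have hdist : tripleDist h (p₁, p₂, p₃) = p₁ * p₂ * p₃ - h := by
          unfold tripleDist
          dsimp only
          rw [show (h : ℤ) - p₁ * p₂ * p₃ = -(((p₁ * p₂ * p₃ - h : ℕ) : ℤ)) by
            push_cast [Nat.cast_sub hPh]; ring, Int.natAbs_neg, Int.natAbs_natCast]
        rw [hdist, coprime_primesProdBelow_iff]
        intro q hq hqb
        have hqprime : q.Prime := Nat.prime_of_mem_primesBelow hq
        have hqlt : (q : ℝ) < (x : ℝ) ^ (1 / 3 : ℝ) := Nat.lt_ceil.mp (Nat.mem_primesBelow.mp hq).1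
        have hb0 : p₁ * p₂ * p₃ - h ≠ 0 := by omega
        have hmem : q ∈ (p₁ * p₂ * p₃ - h).primeFactors :=
          Nat.mem_primeFactors.mpr ⟨hqprime, hqb, hb0⟩
        have hYq : chenY h x ≤ q := hrough q hmem
        have : (chenY h x : ℝ) ≤ q := by exact_mod_cast hYq
        linarith
    · unfold tripleDist
      dsimp only
      rw [show (h : ℤ) - p₁ * p₂ * p₃ = -(((p₁ * p₂ * p₃ - h : ℕ) : ℤ)) by
        push_cast [Nat.cast_sub hPh]; ring, Int.natAbs_neg, Int.natAbs_natCast]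
  · -- the elements with `p₁p₂p₃ ∈ [x, x + h]`
    calc #(R.filter fun b => ¬ b + h < x) ≤ #(Finset.Icc (x - h) x) := Finset.card_le_card ?_
      _ = x + 1 - (x - h) := Nat.card_Icc _ _
      _ ≤ h + 1 := by omega
    intro b hb
    rw [Finset.mem_filter, hR, Finset.mem_filter] at hb
    obtain ⟨⟨hbB, -⟩, hbx⟩ := hb
    obtain ⟨p₁, p₂, p₃, -, -, -, -, -, -, -, hprod, rfl⟩ := mem_chenSetBShift.mp hbB
    rw [Finset.mem_Icc]
    omega

/-! ### The sieve step -/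

set_option maxHeartbeats 800000 in
/-- **The sieve step of the switching bound for the shift `h`** (Chen's Lemma 8 / Nathanson's
Theorem 10.6 at `z = x^{1/10}`, for the enlarged set `T̃(h, x, ε)`): for even `h ≠ 0`, `0 < ε ≤ 1`,
`0 < δ ≤ 1/8`, `θ > 0` and all large `x`, with `y = x^{1/3}`, `V_h = sieveProduct h`,

`#{t ∈ T̃ : (|h − p₁p₂p₃|, P(y)) = 1} ≤ (2e^γ/(5(1 − 2δ)) + θ) · #T̃ · V_h(x^{1/10}) + R(h, x, ε, x^{1/2−δ})`.

Proof: the uniform linear-sieve upper bound (`LinearSieve.upper_explicit`, level `D = x^{1/2−δ}`) for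
`switchedSeqS h x ε` at height `2x` gives `≤ #T̃ · V_h(y)(2e^γ/s + C(log D)^{−1/3}) + R`,
`s = log D/log y = 3(1/2 − δ)`; and `V_h(y) ≤ (3/10) ρ V_h(x^{1/10})`,
`ρ = (1 + 351/log x)/(1 − 1170/log x) → 1`, by the fixed-shift Mertens estimate
`abs_sieveProduct_sub_le_of_lt` at `y` (`log y = (log x)/3`) and at `x^{1/10}`; finally
`(3/10)(2e^γ/s) = 2e^γ/(5(1 − 2δ))` (`sieve_mainTerm_algebra`, `eventually_switchedSieveFactorT_le`).
[cite: ChenSciSinica1973, Lemma 8 eq. (27) (reprint p. 166)] -/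
theorem switchedCountS_le {h : ℕ} (hh : Even h) (hh0 : h ≠ 0) {ε δ θ : ℝ} (hε : 0 < ε) (hε1 : ε ≤ 1)
    (hδ : 0 < δ) (hδ1 : δ ≤ 1 / 8) (hθ : 0 < θ) :
    ∀ᶠ x : ℕ in atTop,
      (#((switchedTriplesS h x ε).filter fun t : ℕ × ℕ × ℕ =>
          (tripleDist h t).Coprime (primesProdBelow (y x))) : ℝ) ≤
        (2 * Real.exp Real.eulerMascheroniConstant / (5 * (1 - 2 * δ)) + θ) *
            #(switchedTriplesS h x ε) * sieveProduct h ((x : ℝ) ^ (1 / 10 : ℝ)) +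
          switchedRemainderS h x ε ((x : ℝ) ^ (1 / 2 - δ)) := by
  -- the uniform linear sieve, for the dimension class `Ω(1, L₀)`
  obtain ⟨CI, hCI⟩ := LinearSieve.upper_explicit (54 * Real.exp (54 / Real.log 2))
  set G := Real.exp Real.eulerMascheroniConstant with hG
  have hG0 : 0 < G := Real.exp_pos _
  set g' := Real.exp (-Real.eulerMascheroniConstant) with hg'
  have hg'0 : 0 < g' := Real.exp_pos _
  set K := 2 * G / (5 * (1 - 2 * δ)) with hK
  have h12δ : 0 < 1 - 2 * δ := by linarith
  have hK0 : 0 ≤ K := by positivity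
  have ha : 0 < 1 / 2 - δ := by linarith
  have hlog : Tendsto (fun N : ℕ => Real.log N) atTop atTop :=
    Real.tendsto_log_atTop.comp (tendsto_natCast_atTop_atTop (R := ℝ))
  have hz10T : ∀ᶠ x : ℕ in atTop, (h : ℝ) < (x : ℝ) ^ (1 / 10 : ℝ) :=
    ((tendsto_rpow_atTop (by norm_num : (0 : ℝ) < 1 / 10)).comp
      tendsto_natCast_atTop_atTop).eventually_gt_atTop _
  filter_upwards [eventually_ge_atTop (max (3 ^ 8) h), hz10T,
    hlog.eventually_ge_atTop (2 * 1170 + 2 * |(351 : ℝ)|),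
    eventually_switchedSieveFactorT_le K (max CI 0) 351 hθ ha] with N hNmax hz10h hL hfac
  -- basic quantities
  have hN : 3 ^ 8 ≤ N := le_of_max_le_left hNmax
  have hhx : h ≤ N := le_of_max_le_right hNmax
  have hNpos : 0 < N := by omega
  have hN1 : (1 : ℝ) < N := by exact_mod_cast (show 1 < N by omega)
  have hN0' : (0 : ℝ) < N := by linarith
  have hlogN : 0 < Real.log N := Real.log_pos hN1
  set L := Real.log N with hLdef
  have h351 : |(351 : ℝ)| = 351 := abs_of_pos (by norm_num)
  rw [h351] at hL hfac
  have hL3000 : 3042 ≤ L := by linarith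
  set z10 : ℝ := (N : ℝ) ^ (1 / 10 : ℝ) with hz10
  have hlogz10 : Real.log z10 = 1 / 10 * L := Real.log_rpow hN0' _
  set Y : ℝ := y N with hY
  have hY_def : Y = (N : ℝ) ^ (1 / 3 : ℝ) := rfl
  have hY2 : 2 ≤ Y := by
    rw [hY_def, show (2 : ℝ) = ((2 : ℝ) ^ (3 : ℕ)) ^ (1 / 3 : ℝ) by
      rw [← Real.rpow_natCast, ← Real.rpow_mul (by norm_num)]; norm_num]
    exact Real.rpow_le_rpow (by norm_num) (by norm_num; exact_mod_cast (show 8 ≤ N by omega)) (by norm_num)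
  have hlogY : Real.log Y = 1 / 3 * L := Real.log_rpow hN0' _
  have hlogY0 : 0 < Real.log Y := by rw [hlogY]; positivity
  set D : ℝ := (N : ℝ) ^ (1 / 2 - δ) with hD
  have hlogD : Real.log D = (1 / 2 - δ) * L := Real.log_rpow hN0' _
  have hlogD0 : 0 < Real.log D := by rw [hlogD]; positivity
  have hYD : Y ≤ D := Real.rpow_le_rpow_of_exponent_le hN1.le (by linarith)
  have hs3 : Real.log D / Real.log Y ≤ 3 := by
    rw [div_le_iff₀ hlogY0, hlogD, hlogY]
    nlinarith [mul_nonneg hδ.le hlogN.le]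
  -- the sieve inequality for `𝒜̃`
  set A := switchedSeqS h N ε with hA
  have hdim : HasIwaniecDimension A.density 1 (54 * Real.exp (54 / Real.log 2)) :=
    hasIwaniecDimension_shiftedPrimesDensity hh
  have hsize : (0 : ℝ) ≤ A.size ((2 * N : ℕ) : ℝ) := Nat.cast_nonneg _
  have hI := hCI A hdim ((2 * N : ℕ) : ℝ) D Y hY2 hYD hs3 hsize
  -- identify the terms
  have hsift : A.sifted ((2 * N : ℕ) : ℝ) (primesProdBelow Y) =
      #((switchedTriplesS h N ε).filter fun t : ℕ × ℕ × ℕ =>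
        (tripleDist h t).Coprime (primesProdBelow (y N))) := by
    rw [hA, hY, sifted_switchedSeqS_eq hε hε1 hhx]
  have hsizeq : A.size ((2 * N : ℕ) : ℝ) = #(switchedTriplesS h N ε) := rfl
  have hVq : A.densityProduct (primesProdBelow Y) = sieveProduct h Y :=
    densityProduct_switchedSeqS_eq h N ε Y
  have hRq : ∑ d ∈ (Finset.range ⌈D⌉₊).filter (· ∣ primesProdBelow Y),
      |A.remainder d ((2 * N : ℕ) : ℝ)| = switchedRemainderS h N ε D := by
    rw [hA, hY]
    exact sum_abs_remainder_switchedSeqS_eq hε hε1 hhx D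
  rw [hsift, hsizeq, hVq, hRq, hlogD] at hI
  -- the main term
  have hT0 : 0 ≤ (#(switchedTriplesS h N ε) : ℝ) := Nat.cast_nonneg _
  have hVy0 : 0 ≤ sieveProduct h Y := (sieveProduct_mem_Icc hh Y).1
  have hVz0 : 0 ≤ sieveProduct h z10 := (sieveProduct_mem_Icc hh z10).1
  set ρN : ℝ := (1 + 351 / L) / (1 - 1170 / L) with hρN
  have hden : 0 < 1 - 1170 / L := by
    rw [sub_pos, div_lt_one hlogN]; linarith
  have hρN0 : 0 ≤ ρN := by positivity
  -- Mertens at `Y` and at `z10` for the fixed shift `h`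
  have hS0 : 0 < singularSeries h := singularSeries_pos h
  have hhY : (h : ℝ) < Y := by
    refine hz10h.trans_le ?_
    rw [hz10, hY_def]
    exact Real.rpow_le_rpow_of_exponent_le hN1.le (by norm_num)
  have hVY := abs_sieveProduct_sub_le_of_lt hh hh0 (w := Y) (by rw [hlogY]; linarith) hhY
  have hVZ := abs_sieveProduct_sub_le_of_lt hh hh0 (w := z10) (by rw [hlogz10]; linarith) hz10h
  rw [hlogY] at hVY
  rw [hlogz10] at hVZ
  set M10 := 2 * singularSeries h * g' / (1 / 10 * L) with hM10
  have hM10pos : 0 < M10 := by positivity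
  have hMY : 2 * singularSeries h * g' / (1 / 3 * L) = 3 / 10 * M10 := by
    rw [hM10]; field_simp
  rw [hMY] at hVY
  have hVY_le : sieveProduct h Y ≤ 3 / 10 * M10 * (1 + 351 / L) := by
    have h1 := (abs_sub_le_iff.mp hVY).1
    have e1 : 117 * (3 / 10 * M10) / (1 / 3 * L) = 351 * (3 / 10 * M10) / L := by
      field_simp; ring
    rw [e1] at h1
    have e : 3 / 10 * M10 * (1 + 351 / L) = 3 / 10 * M10 + 351 * (3 / 10 * M10) / L := by
      field_simp
    rw [e]
    linarith
  have hVz10_ge : M10 * (1 - 1170 / L) ≤ sieveProduct h z10 := by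
    have h1 := (abs_sub_le_iff.mp hVZ).2
    have e1 : 117 * M10 / (1 / 10 * L) = 1170 * M10 / L := by
      field_simp; ring
    rw [e1] at h1
    have e : M10 * (1 - 1170 / L) = M10 - 1170 * M10 / L := by field_simp
    rw [e]
    linarith
  have hVyle : sieveProduct h Y ≤ sieveProduct h z10 * (3 / 10 * ρN) := by
    have h1 : M10 ≤ sieveProduct h z10 / (1 - 1170 / L) := by
      rw [le_div_iff₀ hden]; exact hVz10_ge
    calc sieveProduct h Y ≤ 3 / 10 * M10 * (1 + 351 / L) := hVY_le
      _ ≤ 3 / 10 * (sieveProduct h z10 / (1 - 1170 / L)) * (1 + 351 / L) := by gcongr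
      _ = sieveProduct h z10 * (3 / 10 * ρN) := by rw [hρN]; field_simp
  -- the factor: `ρN ≤` the factor of `eventually_switchedSieveFactorT_le`
  have hρle : (3 / 10 : ℝ) ≤ 3 / 8 := by norm_num
  have hr0 : 0 ≤ ((1 / 2 - δ) * L) ^ (-(1 / 3 : ℝ)) := Real.rpow_nonneg (by positivity) _
  have hF0 : 0 ≤ 2 * G / ((1 / 2 - δ) * L / Real.log Y) := by positivity
  have hρF : 3 / 10 * (2 * G / ((1 / 2 - δ) * L / Real.log Y)) = K := by
    rw [hK, hlogY]
    field_simp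
    ring
  have hfac' : ρN * K + 3 / 8 * ρN * max CI 0 * ((1 / 2 - δ) * L) ^ (-(1 / 3 : ℝ)) ≤ K + θ := by
    set E' : ℝ := Real.exp (400 / L) * (1 + 1 / ((N : ℝ) ^ (1 / 8 : ℝ) - 1)) ^ 8 with hE'
    have hz8 : (1 : ℝ) < (N : ℝ) ^ (1 / 8 : ℝ) := Real.one_lt_rpow hN1 (by norm_num)
    have hE'1 : 1 ≤ E' := by
      have h1 : 1 ≤ Real.exp (400 / L) := Real.one_le_exp (by positivity)
      have h2 : (1 : ℝ) ≤ (1 + 1 / ((N : ℝ) ^ (1 / 8 : ℝ) - 1)) ^ 8 := by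
        refine one_le_pow₀ ?_
        have : 0 ≤ 1 / ((N : ℝ) ^ (1 / 8 : ℝ) - 1) := div_nonneg zero_le_one (by linarith)
        linarith
      calc (1 : ℝ) = 1 * 1 := by ring
        _ ≤ Real.exp (400 / L) * (1 + 1 / ((N : ℝ) ^ (1 / 8 : ℝ) - 1)) ^ 8 :=
            mul_le_mul h1 h2 zero_le_one (by positivity)
    have hρE : ρN ≤ E' * ρN := le_mul_of_one_le_left hρN0 hE'1
    have hC0 : 0 ≤ max CI 0 := le_max_right _ _
    have hfac2 : E' * ρN * K + 3 / 8 * (E' * ρN) * max CI 0 * ((1 / 2 - δ) * L) ^ (-(1 / 3 : ℝ)) ≤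
        K + θ := by
      simpa only [hE', hρN] using hfac
    have hm1 : ρN * K ≤ E' * ρN * K := mul_le_mul_of_nonneg_right hρE hK0
    have hm2 : 3 / 8 * ρN * max CI 0 * ((1 / 2 - δ) * L) ^ (-(1 / 3 : ℝ)) ≤
        3 / 8 * (E' * ρN) * max CI 0 * ((1 / 2 - δ) * L) ^ (-(1 / 3 : ℝ)) := by
      have := mul_le_mul_of_nonneg_right (mul_le_mul_of_nonneg_right
        (mul_le_mul_of_nonneg_left hρE (by norm_num : (0 : ℝ) ≤ 3 / 8)) hC0) hr0
      exact this
    linarith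
  have hmain := sieve_mainTerm_algebra (C := CI) hT0 hVz0 hVy0 hρN0 hρle hr0 hF0 hVyle hρF hfac'
  -- conclude
  calc (#((switchedTriplesS h N ε).filter fun t : ℕ × ℕ × ℕ =>
          (tripleDist h t).Coprime (primesProdBelow (y N))) : ℝ)
      ≤ (#(switchedTriplesS h N ε) : ℝ) * sieveProduct h Y *
          (2 * G / ((1 / 2 - δ) * L / Real.log Y) +
            CI * ((1 / 2 - δ) * L) ^ (-(1 / 3 : ℝ))) + switchedRemainderS h N ε D := hI
    _ ≤ (#(switchedTriplesS h N ε) : ℝ) * sieveProduct h z10 * (K + θ) +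
          switchedRemainderS h N ε D := by linarith
    _ = (K + θ) * #(switchedTriplesS h N ε) * sieveProduct h z10 + switchedRemainderS h N ε D := by
        ring

end Literature.NumberTheory.Sieve.Chen
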